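import Mathlib
import Summits.ValiantsHypothesis.ValiantsHypothesis.Theorems.NewtonUnitEquationsDissociatedUniformTotalsLawUnimodal
import HarnessLib

/-!
# Crux `NewtonUnitEquations.DissociatedUniform` (stmt-ValiantsHypothesis-5905): the convexly ordered stratum contains the census curves

Companion of `…TotalsLawUnimodal` (`CycUnimodalAt`, `CycUnimodal`, `ConvexlyOrdered`, and the union totals law on the convexly
ordered stratum).  This file shows that the stratum is populated by the curves of the (Q**) census (memo
`Cruxes/DissociatedUniform/NOTES-d1g3.md` §3, `NOTES-t1g4.md` §5: parabola pairs `x ↦ (P x, Q x²)` with natural labels):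
* `cycUnimodalAt_zero_of_peak` / `cycUnimodal_of_valley`: a sequence on the labels `0, 1, …, q-1` that first weakly increases and
  then weakly decreases (Λ-shaped), or first decreases and then increases (V-shaped), is cyclically unimodal (for the V shape the
  mode sits at `q - 1` or at `0`, whichever is larger);
* **`convexlyOrdered_graph`**: the graph `z ↦ (z.val, φ z.val)` of a sequence `φ` with weakly increasing differences (a convex
  sequence) is convexly ordered — every functional `w₀ k + w₁ φ k` has monotone differences, hence is Λ- or V-shaped;
  `ConvexlyOrdered.affine` (affine images), and **`convexlyOrdered_parabola`**: `z ↦ (P·z.val, Q·z.val²)` (any real `P`, `Q`)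
  is convexly ordered.  Hence (`unionTotal_parabolaPair_le`) for two such parabolas the union totals law holds
  with constant `2 + #bdry Z` by `unionTotal_le_of_convexlyOrdered'`.
Honest label: examples for a stratum theorem; nothing here bears on the open laws or on VP ≠ VNP.
[folklore]
-/

set_option linter.dupNamespace false -- `ValiantsHypothesis.ValiantsHypothesis` (summit = problem) in every name

open scoped BigOperators

namespace Summit.ValiantsHypothesis.ValiantsHypothesis.Theorems.NewtonUnitEquationsDissociatedUniform

namespace TotalsLaw

section Graphs

variable {q : ℕ} [NeZero q]

omit [NeZero q] in
/-- Casting a label `k < q` and reading it back. [folklore] -/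
theorem val_natCast_of_lt {k : ℕ} (hk : k < q) : ((k : ZMod q)).val = k := ZMod.val_cast_of_lt hk

omit [NeZero q] in
/-- **Λ-shaped sequences are cyclically unimodal** (witness `n = 0`, mode `p`). [folklore] -/
theorem cycUnimodalAt_zero_of_peak (f : ZMod q → ℝ) (g : ℕ → ℝ) (hfg : ∀ k, k < q → f (k : ZMod q) = g k) {p : ℕ}
    (hp : p < q) (hasc : ∀ k, k < p → g k ≤ g (k + 1)) (hdesc : ∀ k, p ≤ k → k + 1 < q → g (k + 1) ≤ g k) :
    CycUnimodalAt f 0 p := by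
  refine ⟨hp, fun k hk => ?_, fun k hk hk1 => ?_⟩
  · rw [zero_add, zero_add, hfg k (by omega), hfg (k + 1) (by omega)]
    exact hasc k hk
  · rw [zero_add, zero_add, hfg k (by omega), hfg (k + 1) hk1]
    exact hdesc k hk hk1

omit [NeZero q] in
/-- A weakly increasing run: `g j ≤ g k` along `j ≤ k < m` if every step in `[0, m)` goes up. [folklore] -/
theorem le_of_steps_up (g : ℕ → ℝ) {m : ℕ} (h : ∀ k, k + 1 < m → g k ≤ g (k + 1)) {j k : ℕ} (hjk : j ≤ k) (hk : k < m) :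
    g j ≤ g k := by
  induction k with
  | zero => rw [Nat.le_zero.1 hjk]
  | succ k ih =>
    rcases Nat.lt_or_ge j (k + 1) with hlt | hge
    · exact (ih (Nat.lt_succ_iff.1 hlt) (by omega)).trans (h k hk)
    · rw [le_antisymm hjk hge]

omit [NeZero q] in
/-- **V-shaped sequences are cyclically unimodal**: first weakly decreasing (up to `p`), then weakly increasing; the mode is the
larger of the two ends `g (q-1)`, `g 0`. [folklore] -/
theorem cycUnimodal_of_valley (f : ZMod q → ℝ) (g : ℕ → ℝ) (hfg : ∀ k, k < q → f (k : ZMod q) = g k) {p : ℕ} (hp : p < q)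
    (hdesc : ∀ k, k < p → g (k + 1) ≤ g k) (hasc : ∀ k, p ≤ k → k + 1 < q → g k ≤ g (k + 1)) : CycUnimodal f := by
  have hq : (q : ZMod q) = 0 := ZMod.natCast_self q
  -- labels past `q - 1` wrap around: `p + k + 1 = q + j`
  have hwrap : ∀ j : ℕ, ((q + j : ℕ) : ZMod q) = (j : ZMod q) := fun j => by push_cast; rw [hq, zero_add]
  by_cases hA : g 0 ≤ g (q - 1)
  · -- Case A: mode at the label `q - 1`
    refine ⟨(p : ZMod q), q - 1 - p, by omega, fun k hk => ?_, fun k hk hk1 => ?_⟩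
    · have e1 : (p : ZMod q) + (k : ZMod q) = ((p + k : ℕ) : ZMod q) := by push_cast; ring
      have e2 : (p : ZMod q) + ((k + 1 : ℕ) : ZMod q) = ((p + k + 1 : ℕ) : ZMod q) := by push_cast; ring
      rw [e1, e2, hfg _ (by omega), hfg _ (by omega)]
      exact hasc (p + k) (by omega) (by omega)
    · -- here `p + k + 1 ≥ q`
      obtain ⟨j, hj⟩ : ∃ j : ℕ, p + k + 1 = q + j := ⟨p + k + 1 - q, by omega⟩
      have e2 : (p : ZMod q) + ((k + 1 : ℕ) : ZMod q) = (j : ZMod q) := by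
        rw [← hwrap j, ← hj]; push_cast; ring
      rcases Nat.eq_zero_or_pos j with hj0 | hjpos
      · -- the wrap step `q - 1 → 0`
        have e1 : (p : ZMod q) + (k : ZMod q) = ((q - 1 : ℕ) : ZMod q) := by
          rw [show q - 1 = p + k by omega]; push_cast; ring
        rw [e1, e2, hj0, hfg 0 (by omega), hfg _ (by omega)]
        exact hA
      · have e1 : (p : ZMod q) + (k : ZMod q) = ((j - 1 : ℕ) : ZMod q) := by
          rw [← hwrap (j - 1), show q + (j - 1) = p + k by omega]; push_cast; ring
        rw [e1, e2, hfg _ (by omega), hfg _ (by omega)]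
        have := hdesc (j - 1) (by omega)
        rwa [show j - 1 + 1 = j by omega] at this
  · -- Case B: `g (q-1) < g 0`, mode at the label `0`; then `p ≥ 1`
    push Not at hA
    have hp1 : 1 ≤ p := by
      by_contra h0
      have : g 0 ≤ g (q - 1) :=
        le_of_steps_up g (m := q) (fun k hk => hasc k (by omega) hk) (Nat.zero_le _) (by omega)
      linarith
    refine ⟨(p : ZMod q), q - p, by omega, fun k hk => ?_, fun k hk hk1 => ?_⟩
    · have e1 : (p : ZMod q) + (k : ZMod q) = ((p + k : ℕ) : ZMod q) := by push_cast; ring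
      by_cases hlast : p + k + 1 = q
      · -- the wrap step `q - 1 → 0`, upwards in this case
        have e2 : (p : ZMod q) + ((k + 1 : ℕ) : ZMod q) = ((0 : ℕ) : ZMod q) := by
          rw [← hwrap 0, add_zero, ← hlast]; push_cast; ring
        rw [e1, e2, hfg _ (by omega), hfg 0 (by omega), show p + k = q - 1 by omega]
        exact hA.le
      · have e2 : (p : ZMod q) + ((k + 1 : ℕ) : ZMod q) = ((p + k + 1 : ℕ) : ZMod q) := by push_cast; ring
        rw [e1, e2, hfg _ (by omega), hfg _ (by omega)]
        exact hasc (p + k) (by omega) (by omega)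
    · obtain ⟨j, hj⟩ : ∃ j : ℕ, p + k = q + j := ⟨p + k - q, by omega⟩
      have e1 : (p : ZMod q) + (k : ZMod q) = (j : ZMod q) := by rw [← hwrap j, ← hj]; push_cast; ring
      have e2 : (p : ZMod q) + ((k + 1 : ℕ) : ZMod q) = ((j + 1 : ℕ) : ZMod q) := by
        rw [← hwrap (j + 1), show q + (j + 1) = p + k + 1 by omega]; push_cast; ring
      rw [e1, e2, hfg _ (by omega), hfg _ (by omega)]
      exact hdesc j (by omega)

omit [NeZero q] in
/-- Monotone differences propagate along a run. [folklore] -/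
theorem diff_le_diff_of_le (Δ : ℕ → ℝ) {m : ℕ} (h : ∀ k, k + 1 < m → Δ k ≤ Δ (k + 1)) {j k : ℕ} (hjk : j ≤ k) (hk : k < m) :
    Δ j ≤ Δ k :=
  le_of_steps_up Δ h hjk hk

/-- The pairing of a weight with a graph point. [folklore] -/
theorem dotProduct_graph (w : Fin 2 → ℝ) (x y : ℝ) : w ⬝ᵥ ![x, y] = w 0 * x + w 1 * y := by
  simp [dotProduct, Fin.sum_univ_two]

/-- **Graphs of convex sequences are convexly ordered.**  If `φ : ℕ → ℝ` has weakly increasing differences on the labels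
`0, …, q-1`, then the curve `z ↦ (z.val, φ z.val)` is convexly ordered: every functional `k ↦ w₀ k + w₁ φ k` has monotone
differences, so it is V-shaped (`w₁ ≥ 0`) or Λ-shaped (`w₁ ≤ 0`). [folklore] -/
theorem convexlyOrdered_graph (φ : ℕ → ℝ) (hφ : ∀ k, k + 2 < q → φ (k + 1) - φ k ≤ φ (k + 2) - φ (k + 1)) :
    ConvexlyOrdered (fun z : ZMod q => ![(z.val : ℝ), φ z.val]) := by
  intro w
  set g : ℕ → ℝ := fun k => w 0 * k + w 1 * φ k with hgdef
  set Δ : ℕ → ℝ := fun k => g (k + 1) - g k with hΔdef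
  have hfg : ∀ k, k < q → (fun z : ZMod q => w ⬝ᵥ ![(z.val : ℝ), φ z.val]) (k : ZMod q) = g k := by
    intro k hk
    simp only [hgdef]
    rw [dotProduct_graph, val_natCast_of_lt hk]
  have hΔ : ∀ k, Δ k = w 0 + w 1 * (φ (k + 1) - φ k) := fun k => by
    simp only [hΔdef, hgdef]; push_cast; ring
  have hq1 : 1 ≤ q := Nat.one_le_iff_ne_zero.2 (NeZero.ne q)
  rcases le_total 0 (w 1) with hw | hw
  · -- `w₁ ≥ 0`: increasing differences, V-shaped
    have hmono : ∀ k, k + 1 < q - 1 → Δ k ≤ Δ (k + 1) := by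
      intro k hk
      rw [hΔ, hΔ]
      have := hφ k (by omega)
      nlinarith
    classical
    have hex : ∃ p : ℕ, q ≤ p + 1 ∨ 0 ≤ Δ p := ⟨q - 1, Or.inl (by omega)⟩
    set p := Nat.find hex with hpdef
    have hpspec : q ≤ p + 1 ∨ 0 ≤ Δ p := Nat.find_spec hex
    have hple : p ≤ q - 1 := by
      have := Nat.find_min' hex (m := q - 1) (Or.inl (by omega))
      rwa [← hpdef] at this
    refine cycUnimodal_of_valley _ g hfg (p := p) (by omega) (fun k hk => ?_) (fun k hk hk1 => ?_)
    · have hmin := Nat.find_min hex (hpdef ▸ hk)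
      push Not at hmin
      have : Δ k < 0 := hmin.2
      simp only [hΔdef] at this
      linarith
    · have h0 : 0 ≤ Δ p := by
        rcases hpspec with h | h
        · omega
        · exact h
      have h1 : Δ p ≤ Δ k := diff_le_diff_of_le Δ (m := q - 1) hmono hk (by omega)
      have : 0 ≤ Δ k := h0.trans h1
      simp only [hΔdef] at this
      linarith
  · -- `w₁ ≤ 0`: decreasing differences, Λ-shaped
    have hmono : ∀ k, k + 1 < q - 1 → -Δ k ≤ -Δ (k + 1) := by
      intro k hk
      rw [hΔ, hΔ]
      have := hφ k (by omega)
      nlinarith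
    classical
    have hex : ∃ p : ℕ, q ≤ p + 1 ∨ Δ p ≤ 0 := ⟨q - 1, Or.inl (by omega)⟩
    set p := Nat.find hex with hpdef
    have hpspec : q ≤ p + 1 ∨ Δ p ≤ 0 := Nat.find_spec hex
    have hple : p ≤ q - 1 := by
      have := Nat.find_min' hex (m := q - 1) (Or.inl (by omega))
      rwa [← hpdef] at this
    refine ⟨0, p, cycUnimodalAt_zero_of_peak _ g hfg (p := p) (by omega) (fun k hk => ?_) (fun k hk hk1 => ?_)⟩
    · have hmin := Nat.find_min hex (hpdef ▸ hk)
      push Not at hmin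
      have : 0 < Δ k := hmin.2
      simp only [hΔdef] at this
      linarith
    · have h0 : Δ p ≤ 0 := by
        rcases hpspec with h | h
        · omega
        · exact h
      have h1 : -Δ p ≤ -Δ k := diff_le_diff_of_le (fun k => -Δ k) (m := q - 1) hmono hk (by omega)
      have : Δ k ≤ 0 := by linarith
      simp only [hΔdef] at this
      linarith

omit [NeZero q] in
/-- Adding a constant keeps a witness. [folklore] -/
theorem CycUnimodalAt.add_const {f : ZMod q → ℝ} {n : ZMod q} {d : ℕ} (h : CycUnimodalAt f n d) (c : ℝ) :
    CycUnimodalAt (fun x => f x + c) n d :=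
  ⟨h.1, fun k hk => by simpa using h.2.1 k hk, fun k hk hk1 => by simpa using h.2.2 k hk hk1⟩

omit [NeZero q] in
/-- **Affine images of convexly ordered curves are convexly ordered** (`⟨w, M a x + v⟩ = ⟨Mᵀ w, a x⟩ + ⟨w, v⟩`). [folklore] -/
theorem ConvexlyOrdered.affine {a : ZMod q → (Fin 2 → ℝ)} (ha : ConvexlyOrdered a) (M : Matrix (Fin 2) (Fin 2) ℝ)
    (v : Fin 2 → ℝ) : ConvexlyOrdered fun x => M.mulVec (a x) + v := by
  intro w
  obtain ⟨n, d, h⟩ := ha (Matrix.vecMul w M)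
  refine ⟨n, d, ?_⟩
  have key : (fun x => w ⬝ᵥ (M.mulVec (a x) + v)) = fun x => (Matrix.vecMul w M) ⬝ᵥ a x + w ⬝ᵥ v := by
    funext x
    rw [dotProduct_add, Matrix.dotProduct_mulVec]
  rw [key]
  exact h.add_const _

/-- **The census parabolas are convexly ordered**: `z ↦ (P·z.val, Q·z.val²)` for any real `P` and `Q`. [folklore] -/
theorem convexlyOrdered_parabola (P Q : ℝ) :
    ConvexlyOrdered (fun z : ZMod q => ![P * (z.val : ℝ), Q * (z.val : ℝ) ^ 2]) := by
  have hsq : ConvexlyOrdered (fun z : ZMod q => ![(z.val : ℝ), ((z.val : ℝ)) ^ 2]) := by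
    have h := convexlyOrdered_graph (q := q) (fun k => (k : ℝ) ^ 2) (fun k _ => by push_cast; nlinarith)
    simpa using h
  have h2 := hsq.affine (Matrix.of ![![P, 0], ![0, Q]]) 0
  convert h2 using 2 with z
  ext i
  fin_cases i <;> simp <;> ring

/-- **The union totals law for a pair of census parabolas**: for `a z = (P z, Q z²)`, `b z = (P' z, Q' z²)` (natural labels) and
ANY position set `Z`, `unionTotal a b Z ≤ (2 + #bdry Z)·q²`. [folklore] -/
theorem unionTotal_parabolaPair_le (P Q P' Q' : ℝ) (Z : Finset (ZMod q)) :
    unionTotal (fun z : ZMod q => ![P * (z.val : ℝ), Q * (z.val : ℝ) ^ 2])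
        (fun z : ZMod q => ![P' * (z.val : ℝ), Q' * (z.val : ℝ) ^ 2]) (Z : Set (ZMod q)) ≤ (2 + (bdry Z).card) * q ^ 2 :=
  unionTotal_le_of_convexlyOrdered' _ _ (convexlyOrdered_parabola P Q) (convexlyOrdered_parabola P' Q') Z

end Graphs

end TotalsLaw

end Summit.ValiantsHypothesis.ValiantsHypothesis.Theorems.NewtonUnitEquationsDissociatedUniform
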